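import Summits.ABC.ABC.Theorems.DefiniteXiDefiniteRTControlPrimeOfTakahashi
import HarnessLib

/-!
# stub-ideation k1 gen19 — `stub_xiDegreeComparison` (stmt-ABC-15024, line `p6_tamagawa_split`)

Plan T♮ (FAMILY 1, transfer from the solved sibling crux `DefiniteRTControlPrime`): the prime-type
child 1 `cps ξ(N/q;q) ≤ C N^ε cps(deg D_min) T³` modulo `takahashi2001_thm_2_3_of_coprime` +
`FreyModularity` ONLY — the two Pasten facts (`…_le_163_mul` = item MazurKenkuBound,
`…lemma_6_8` = item IsogenyValuationTransport) of `xiDegreeComparison_prime_of_facts` (p137891) are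
replaced by the LANDED sub-polynomial rooted isogeny radius `OfTakahashi.freyIsogenyRadiusSubpoly`
and the LANDED Tate-curve transport `factorization_le_mul_of_isogeny` /
`modularDegree_le_degree_mul`, exactly as the k2 programme did for `DefiniteRTControlPrime`
(`deg_le_of_optimalIsogenyAt`, `definiteRTControlPrime_of_takahashi`).

Statements only (sorried) — elaboration sanity check; provers land them under `Theorems/`.
-/

set_option linter.dupNamespace false

noncomputable section

namespace Summit.ABC.ABC.Cruxes.SteinbergCore.StubIdeasK1G19

open Summit.ABC.ABC.Theses.DefiniteXi
open Summit.ABC.ABC.Theorems Summit.ABC.ABC.Theorems.DefiniteRTControlPrime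
open Summit.ABC.ABC.Theorems.DefiniteRTControlPrime.OfTakahashi
open Literature.NumberTheory.EllipticCurves Literature.NumberTheory.EllipticCurves.ModularForms
open Literature.NumberTheory.Automorphic
open WeierstrassCurve

/-- **H0 · `primeToSix_chain'`** (XS) — the `cps` chain of p137891 with the two constants as
parameters: from `P i = ξ j` (`j ≠ 0`), `P = δ₀ m⋆`, `d = δ₀ m_E` (`m_E ≠ 0`), `m⋆ ≤ K`, `i ≤ L v`:
`cps ξ ≤ K L · cps d · v`. Proof: the `calc` of `XiDegreeComparisonPrime.primeToSix_chain` verbatim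
with `4·163 ↦ K`, `163 ↦ L`. -/
theorem primeToSix_chain' {ξ j P δ₀ ms mE d i K L v : ℕ} (hδ : P * i = ξ * j) (hj : j ≠ 0)
    (hP : P = δ₀ * ms) (hd : d = δ₀ * mE) (hmE0 : mE ≠ 0) (hms : ms ≤ K) (hi : i ≤ L * v) :
    ξ / (ordProj[2] ξ * ordProj[3] ξ) ≤ K * L * (d / (ordProj[2] d * ordProj[3] d)) * v := by
  sorry

/-- **H1 · `modularDegree_le_of_isogeny`** (S) — the `(T_deg)` block of `deg_le_of_optimalIsogenyAt`
isolated: ONE `ℚ`-isogeny `φ : W → V` bounds the minimal degree of the data of a global minimal model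
`C • W` with newform `P.f` by `deg φ · deg P`.  Proof: dual of `(toIsogeny V Cs) ∘ φ`
(`exists_dual_degree_eq`), conjugated onto the short models (`shortModel_baseChange_eq_curve`,
`VariableChange.toIsogeny`, `degree_comp`, `degree_toIsogeny`), then `modularDegree_le_degree_mul`. -/
theorem modularDegree_le_of_isogeny {N : ℕ} [NeZero N] {V W : WeierstrassCurve ℚ} [V.IsElliptic]
    [W.IsElliptic] (C : VariableChange ℚ) [(C • W).IsGloballyMinimal]
    (P : ModularParametrizationData V N) (D₁ : ModularParametrizationData (C • W) N)
    (hf : D₁.f = P.f)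
    (hD₁min : ∀ D'' : ModularParametrizationData (C • W) N, D₁.modularDegree ≤ D''.modularDegree)
    (φ : Isogeny W V) : D₁.modularDegree ≤ φ.degree * P.modularDegree := by
  sorry

/-- **H2 · `primeToSix_xi_le_of_isogenyRadiusAt`** (M, the load-bearing helper) — pointwise core in
`ℕ` at ONE `(a, b, q)`, `N = M q`, `q` an odd prime: if every curve `ℚ`-isogenous to `E = E_(a,b)` is
reached by an isogeny of degree `≤ B`, then for a datum `D` of minimal degree of the Frey model
`cps ξ(M; q)(a(E)) ≤ 4 B² · cps (deg D) · v_q(Δ_min E)`.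
Proof = the body of `xiDegreeComparison_prime_of_facts` (p137891) with exactly two substitutions:
`h163'` ↦ `modularDegree_le_of_isogeny Cv D₀ D₁ _ hD₁min φ₀` for `φ₀ : E → W₀` from `hRoot`
(`W₀` the class-optimal curve of `D.exists_optimalDatum'`, isogenous by `isIsogenous_of_f_eq D D₀ hf₀`),
giving `m_E ≤ 4 B`; and `hval` ↦ `factorization_le_mul_of_isogeny hab h0 hq hq2 hqN' φ hφ` for
`φ : E → W⋆` from `hRoot` (`W⋆` the pivot of `exists_conductorMinimal D hN`), giving `i ≤ B v_q`;
then `primeToSix_chain'` with `K = 4 B`, `L = B`. -/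
theorem primeToSix_xi_le_of_isogenyRadiusAt (hT : takahashi2001_thm_2_3_of_coprime) {a b : ℤ}
    (hab : IsCoprime a b) (h0 : a * b * (a + b) ≠ 0) {M q : ℕ} [NeZero (M * q)]
    (hN : (freyCurve a b).conductorNorm ℤ = M * q) (hq : q.Prime) (hq2 : q ≠ 2) {B : ℕ}
    (hRoot : ∀ (W' : WeierstrassCurve ℚ) [W'.IsElliptic], (freyCurve a b).IsIsogenous W' →
      ∃ φ : Isogeny (freyCurve a b) W', φ.degree ≤ B)
    (D : ModularParametrizationData (freyCurve a b) (M * q))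
    (hDmin : ∀ D' : ModularParametrizationData (freyCurve a b) (M * q), D.deg ≤ D'.deg) :
    brandtXi M q (fun n => (freyCurve a b).LFunction n) /
        (ordProj[2] (brandtXi M q (fun n => (freyCurve a b).LFunction n)) *
          ordProj[3] (brandtXi M q (fun n => (freyCurve a b).LFunction n))) ≤
      4 * B * B * (D.deg / (ordProj[2] D.deg * ordProj[3] D.deg)) *
        ((freyCurve a b).minimalDiscriminantNorm ℤ).factorization q := by
  sorry

/-- **H3 · `xiDegreeComparison_prime_of_isogenyRadiusSubpoly`** (S) — the `ε`-wrapper: child 1 at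
prime type with `C(ε) = 4 · (max R(ε/2) 0)²`, verbatim the binder `hC` of
`SteinbergCorePrimeRung.primeRung_of_subs_frey` / the conclusion of `xiDegreeComparison_prime_of_facts`.
Proof: as `definiteRTControlPrime_of_optimalRadiusSubpoly` (`B := ⌊max R 0 · N^(ε/2)⌋₊`,
`Nat.le_floor`, `Real.rpow_add'`), the witness `D` from `exists_minimal_datum (hMod a b hab h0 N hN)`,
`v_q ≤ T` by `Finset.single_le_prod'` with `one_le_factorization_of_mem_primeFactors_conductorNorm`,
`T ≤ T³`, and H2. -/
theorem xiDegreeComparison_prime_of_isogenyRadiusSubpoly (hT : takahashi2001_thm_2_3_of_coprime)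
    (hRad : FreyIsogenyRadiusSubpoly) (hMod : FreyModularity) :
    ∀ ε : ℝ, 0 < ε → ∃ C : ℝ, ∀ a b : ℤ, IsCoprime a b → a * b * (a + b) ≠ 0 → ∀ (N : ℕ) [NeZero N],
      (freyCurve a b).conductorNorm ℤ = N → ∀ q : ℕ, q.Prime → q ≠ 2 → q ∣ N →
      brandtXi (N / q) q (fun n => (freyCurve a b).LFunction n) ≠ 0 →
      ∃ D : ModularParametrizationData (freyCurve a b) N,
        (∀ D' : ModularParametrizationData (freyCurve a b) N, D.deg ≤ D'.deg) ∧
        ((brandtXi (N / q) q (fun n => (freyCurve a b).LFunction n) /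
            (ordProj[2] (brandtXi (N / q) q (fun n => (freyCurve a b).LFunction n)) *
              ordProj[3] (brandtXi (N / q) q (fun n => (freyCurve a b).LFunction n))) : ℕ) : ℝ) ≤
          C * (N : ℝ) ^ ε * ((D.deg / (ordProj[2] D.deg * ordProj[3] D.deg) : ℕ) : ℝ) *
            ((∏ p ∈ N.primeFactors,
              ((freyCurve a b).minimalDiscriminantNorm ℤ).factorization p : ℕ) : ℝ) ^ 3 := by
  sorry

/-- **H4 · `xiDegreeComparison_prime_of_takahashi`** (XS) — the prime-type child 1 modulo
Takahashi 2001 Thm. 2.3 and `FreyModularity` ONLY: H3 fed the unconditional radius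
`OfTakahashi.freyIsogenyRadiusSubpoly`.  (Sanity: this term elaborates against H3.) -/
theorem xiDegreeComparison_prime_of_takahashi (hT : takahashi2001_thm_2_3_of_coprime)
    (hMod : FreyModularity) :
    ∀ ε : ℝ, 0 < ε → ∃ C : ℝ, ∀ a b : ℤ, IsCoprime a b → a * b * (a + b) ≠ 0 → ∀ (N : ℕ) [NeZero N],
      (freyCurve a b).conductorNorm ℤ = N → ∀ q : ℕ, q.Prime → q ≠ 2 → q ∣ N →
      brandtXi (N / q) q (fun n => (freyCurve a b).LFunction n) ≠ 0 →
      ∃ D : ModularParametrizationData (freyCurve a b) N,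
        (∀ D' : ModularParametrizationData (freyCurve a b) N, D.deg ≤ D'.deg) ∧
        ((brandtXi (N / q) q (fun n => (freyCurve a b).LFunction n) /
            (ordProj[2] (brandtXi (N / q) q (fun n => (freyCurve a b).LFunction n)) *
              ordProj[3] (brandtXi (N / q) q (fun n => (freyCurve a b).LFunction n))) : ℕ) : ℝ) ≤
          C * (N : ℝ) ^ ε * ((D.deg / (ordProj[2] D.deg * ordProj[3] D.deg) : ℕ) : ℝ) *
            ((∏ p ∈ N.primeFactors,
              ((freyCurve a b).minimalDiscriminantNorm ℤ).factorization p : ℕ) : ℝ) ^ 3 :=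
  xiDegreeComparison_prime_of_isogenyRadiusSubpoly hT OfTakahashi.freyIsogenyRadiusSubpoly hMod

/-- **H2′ (bonus, XS) · the `163`-leg** — the same core fed the route item `MazurKenkuRadius`
(stmt-ABC-15193) through `freyIsogenyRadius_of_mazurKenkuRadius`: `C = 4·163²`, no `N^ε` needed —
shows H2 subsumes p137891's constant. Statement only. -/
theorem primeToSix_xi_le_of_mazurKenkuRadius (hT : takahashi2001_thm_2_3_of_coprime)
    (hR : MazurKenkuRadius) {a b : ℤ}
    (hab : IsCoprime a b) (h0 : a * b * (a + b) ≠ 0) {M q : ℕ} [NeZero (M * q)]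
    (hN : (freyCurve a b).conductorNorm ℤ = M * q) (hq : q.Prime) (hq2 : q ≠ 2)
    (D : ModularParametrizationData (freyCurve a b) (M * q))
    (hDmin : ∀ D' : ModularParametrizationData (freyCurve a b) (M * q), D.deg ≤ D'.deg) :
    brandtXi M q (fun n => (freyCurve a b).LFunction n) /
        (ordProj[2] (brandtXi M q (fun n => (freyCurve a b).LFunction n)) *
          ordProj[3] (brandtXi M q (fun n => (freyCurve a b).LFunction n))) ≤
      4 * 163 * 163 * (D.deg / (ordProj[2] D.deg * ordProj[3] D.deg)) *
        ((freyCurve a b).minimalDiscriminantNorm ℤ).factorization q :=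
  primeToSix_xi_le_of_isogenyRadiusAt hT hab h0 hN hq hq2
    (fun W' _ hiso => freyIsogenyRadius_of_mazurKenkuRadius hR a b hab h0 q hq hq2
      (by rw [hN]; exact Dvd.intro_left M rfl) W' hiso) D hDmin

end Summit.ABC.ABC.Cruxes.SteinbergCore.StubIdeasK1G19

end
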